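import Mathlib
import HarnessLib
import Literature.Barriers.QuantumFields.CenterSymmetryBreakingByQuarks
import Literature.MathematicalPhysics.QuantumFieldTheory.WilsonPlaquetteWeakCouplingFloorSU2
import Summits.Ventures.LatticeQCDFlow.Scaling.AutoregressiveGaugeAcceptanceCeiling

/-!
# LatticeQCDFlow / Scaling — the volume-uniform acceptance ceiling made EXPLICIT for `SU(2)`:
# `ā ≤ 1 − ¼(1 − (9 + 2 log K)/K) = ¾ + (9 + 2 log K)/(4K)`, `K = (d−1)β ≥ 2`, every `d ≥ 2`, `L ≥ 2`

HONEST FRAMING: exact (Metropolis-corrected) sampling algorithms for lattice gauge theory;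
figures of merit are autocorrelation/cost numbers at stated couplings and volumes; no
continuum-physics claim.

Venture `LatticeQCDFlow` (cell pub-lqcd), topic `Scaling`, FANOUT row 30 (lean-1, GEN-21) — OUR WORK:
`Scaling/AutoregressiveGaugeAcceptanceCeiling` proved, for every compact gauge group with a continuous
representation having a non-trivial central scalar, that an exact sampler whose autoregressive proposal
generates some link after its staple from a conditional not reading the links at one endpoint of that link
accepts in equilibrium at most `1 − ¼⟨(1/N) Re tr U_p⟩_β` (`wilson_meanAccept_le_of_vertexBlind`), and
`Scaling/AutoregressiveGaugeAcceptanceCeilingGroups` specialised the linked `r`-ball form to `SU(n)` and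
`U(1)` WITHOUT evaluating the Haar small-ball mass.  Here the number is evaluated for `SU(2)` with the
tree's explicit plaquette floor `⟨½ Re tr U_p⟩_{Λ_L,β} ≥ 1 − (9 + 2 log K)/K`
(`Literature/…/WilsonPlaquetteWeakCouplingFloorSU2.wilsonExpectation_plaquette_ge_su2`, `K = (d−1)β ≥ 2`).

## What is proved (all [ours])

* §1 **`wilson_meanAccept_le_one_sub_quarter_floor`** — the ceiling against ANY common floor: under the
  hypotheses of `wilson_meanAccept_le_of_vertexBlind` (continuous `ρ` into `N × N` matrices, `N ≥ 1`, a
  central element acting by `ω ≠ 1`, `L ≥ 2`, any `β`), every real `w ≤ ⟨(1/N) Re tr ρ(U_p)⟩_β` gives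
  `ā ≤ 1 − w/4` — the form into which any explicit plaquette floor is plugged.
* §2 **`su2_meanAccept_le_explicit`** — `SU(2)` (`fundamentalRep (Fin 2)`, central element `−1`), `d ≥ 2`,
  `L ≥ 2`, `K = (d−1)β ≥ 2`; plaquette `p` with closing link `a`, ANY integrated set `s` off the
  plaquette, ANY bounded measurable proposal density `Q` whose conditional at `a` is `q`, `q` blind to the
  other links at one endpoint of `a`:  `ā ≤ 1 − ¼·(1 − (9 + 2 log K)/K)`;
  **`su2_meanAccept_le_three_quarters_add`** — the same written as `ā ≤ ¾ + (9 + 2 log K)/(4K)`;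
  **`su2_meanAccept_le_explicit_dim_four`** — `d = 4`, `β ≥ 2/3` (`K = 3β`):
  `ā ≤ ¾ + (9 + 2 log(3β))/(12β)`.

READING (value-free): for four-dimensional `SU(2)` an exact sampler of the stated kind rejects at least
`¼ − (9 + 2 log(3β))/(12β)` of its proposals at every volume `L ≥ 2`; the bound is informative once
`9 + 2 log(3β) < 3β` and tends to `¼` as `β → ∞`.  NOT CLAIMED: conditioners reading both endpoints;
any sharpness of the constants `9`, `2`; the `SU(3)` number (it needs an explicit `SU(3)` small-ball
bound, not in this file).  No `def`, no `sorry`, nothing cited as a fact beyond the tree.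
-/

noncomputable section

namespace Summit.Ventures.LatticeQCDFlow.Theory2.Autoregressive

open MeasureTheory Function Set
open Literature.MathematicalPhysics.QuantumFieldTheory Literature.MathematicalPhysics.QuantumLattice
open Summit.Ventures.LatticeQCDFlow.Exactness
open scoped Matrix Matrix.Norms.Frobenius

/-! ## §1 The ceiling against any plaquette floor -/

section General

variable {d L N : ℕ} {G : Type*} [Group G] [TopologicalSpace G] [IsTopologicalGroup G]
  [CompactSpace G] [SecondCountableTopology G] [MeasurableSpace G] [BorelSpace G] [NeZero L]
  (ρ : G →* Matrix (Fin N) (Fin N) ℂ)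

/-- **The acceptance ceiling against a plaquette floor.**  Continuous `ρ` (`N ≥ 1`) with a central element
acting by a scalar `ω ≠ 1`, `L ≥ 2`, any `β`; plaquette `p` with closing link `a = (p.1, p.2.1.1)`; `s`
any set of links off the plaquette; a bounded measurable proposal density `Q` (`∫Q dπ = 1`) whose
conditional at `a` is `q` (`A_s Q = q·A_{insert a s}Q`, `q ≥ 0` bounded measurable, normalised in `a`),
`q` blind to the other links at the endpoint `y` of `a`.  If `w ≤ ⟨(1/N) Re tr ρ(U_p)⟩_β` then the
equilibrium acceptance of the exact independence sampler is `≤ 1 − w/4`. [ours] -/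
theorem wilson_meanAccept_le_one_sub_quarter_floor (hN : 1 ≤ N) (hρ : Continuous ρ) (hL : 2 ≤ L)
    {z : G} {ω : ℂ} (hω : ρ z = ω • (1 : Matrix (Fin N) (Fin N) ℂ)) (hne : ω ≠ 1) (β : ℝ)
    (p : Plaquette d L) {s : Finset (Edge d L)}
    (hs : s ⊆ Finset.univ \
      {(p.1, p.2.1.1), (p.1.shift p.2.1.1, p.2.1.2), (p.1.shift p.2.1.2, p.2.1.1), (p.1, p.2.1.2)})
    {Q q : GaugeConfig d L G → ℝ} (hQm : Measurable Q) (hQ0 : ∀ U, 0 ≤ Q U) {CQ : ℝ}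
    (hQb : ∀ U, Q U ≤ CQ) (hQ1 : ∫ U, Q U ∂Measure.pi (fun _ : Edge d L => haarProbability G) = 1)
    (hqm : Measurable q) (hq0 : ∀ U, 0 ≤ q U) {Cq : ℝ} (hqb : ∀ U, q U ≤ Cq)
    (hq1 : ∀ U, ∫ v, q (update U (p.1, p.2.1.1) v) ∂(haarProbability G) = 1)
    (hfac : ∀ U, coordAvg (haarProbability G) s Q U =
      q U * coordAvg (haarProbability G) (insert (p.1, p.2.1.1) s) Q U)
    {y : Site d L} (hy : p.1 = y ∨ p.1.shift p.2.1.1 = y)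
    (hqB : ∀ e : Edge d L, e.1 = y ∨ e.1.shift e.2 = y → e ≠ (p.1, p.2.1.1) →
      ∀ (U : GaugeConfig d L G) (v : G), q (update U e v) = q U)
    {w : ℝ} (hw : w ≤ wilsonExpectation ρ β
      (fun U : GaugeConfig d L G => (N : ℝ)⁻¹ * (ρ (plaquetteHolonomy U p.1 p.2.1.1 p.2.1.2)).trace.re)) :
    ∫ U, ∫ V, min
        (Real.exp (-β * wilsonAction ρ U) /
            (∫ W, Real.exp (-β * wilsonAction ρ W) ∂Measure.pi (fun _ : Edge d L => haarProbability G)) *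
          Q V)
        (Real.exp (-β * wilsonAction ρ V) /
            (∫ W, Real.exp (-β * wilsonAction ρ W) ∂Measure.pi (fun _ : Edge d L => haarProbability G)) *
          Q U)
        ∂Measure.pi (fun _ : Edge d L => haarProbability G)
        ∂Measure.pi (fun _ : Edge d L => haarProbability G) ≤ 1 - (1 / 4) * w := by
  set π := Measure.pi (fun _ : Edge d L => haarProbability G) with hπ
  set Z : ℝ := ∫ W, Real.exp (-β * wilsonAction ρ W) ∂π with hZ
  set X : ℝ := ∫ U, (ρ (plaquetteHolonomy U p.1 p.2.1.1 p.2.1.2)).trace.re *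
    Real.exp (-β * wilsonAction ρ U) ∂π with hX
  have hZpos : 0 < Z :=
    integral_exp_pos (Literature.Probability.LatticeModels.integrable_of_continuous_compactSpace _
      (Real.continuous_exp.comp (continuous_const.mul (continuous_wilsonAction ρ hρ))))
  have hNr : (0 : ℝ) < N := by exact_mod_cast hN
  -- the ceiling in terms of the plaquette mean
  have hceil := wilson_meanAccept_le_of_vertexBlind (d := d) (L := L) ρ hρ hL hω hne β p hs hQm hQ0 hQb
    hQ1 hqm hq0 hqb hq1 hfac hy hqB
  -- the floor on `⟨(1/N) Re tr U_p⟩ = N⁻¹ X / Z`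
  rw [wilsonExpectation_eq_integral_div ρ hρ] at hw
  have hnum : ∫ U, (N : ℝ)⁻¹ * (ρ (plaquetteHolonomy U p.1 p.2.1.1 p.2.1.2)).trace.re *
        Real.exp (-β * wilsonAction ρ U) ∂π = (N : ℝ)⁻¹ * X := by
    rw [hX, ← integral_const_mul]
    refine integral_congr_ae (ae_of_all _ fun U => ?_)
    ring
  rw [hnum] at hw
  -- `w ≤ N⁻¹ X / Z = (1/(N Z)) X`, so `¼ w ≤ (1/(4 N Z)) X`
  have hkey : (1 / 4 : ℝ) * w ≤ 1 / (4 * N * Z) * X := by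
    have e : 1 / (4 * N * Z) * X = (1 / 4) * ((N : ℝ)⁻¹ * X / Z) := by
      field_simp
    rw [e]
    exact mul_le_mul_of_nonneg_left hw (by norm_num)
  linarith

end General

/-! ## §2 `SU(2)`: the explicit number -/

section SU2

variable {d L : ℕ} [NeZero L]

/-- **THE EXPLICIT `SU(2)` ACCEPTANCE CEILING.**  `d ≥ 2`, `L ≥ 2`, `K = (d−1)β ≥ 2`; Wilson weight
`e^{−βS_W}` of `SU(2)` (`fundamentalRep (Fin 2)`) on `(ℤ/L)^d`; a plaquette `p` with closing link `a`;
ANY integrated set `s` inside the links off the plaquette; ANY bounded measurable proposal density `Q`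
whose conditional at `a` is `q` (normalised in `a`), `q` blind to the other links at one endpoint of `a`:
`ā ≤ 1 − ¼·(1 − (9 + 2 log K)/K)`. [ours] -/
theorem su2_meanAccept_le_explicit (hd : 2 ≤ d) (hL : 2 ≤ L) {β : ℝ} (hK : 2 ≤ ((d : ℝ) - 1) * β)
    (p : Plaquette d L) {s : Finset (Edge d L)}
    (hs : s ⊆ Finset.univ \
      {(p.1, p.2.1.1), (p.1.shift p.2.1.1, p.2.1.2), (p.1.shift p.2.1.2, p.2.1.1), (p.1, p.2.1.2)})
    {Q q : GaugeConfig d L (Matrix.specialUnitaryGroup (Fin 2) ℂ) → ℝ} (hQm : Measurable Q)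
    (hQ0 : ∀ U, 0 ≤ Q U) {CQ : ℝ} (hQb : ∀ U, Q U ≤ CQ)
    (hQ1 : ∫ U, Q U ∂Measure.pi (fun _ : Edge d L =>
      haarProbability (Matrix.specialUnitaryGroup (Fin 2) ℂ)) = 1)
    (hqm : Measurable q) (hq0 : ∀ U, 0 ≤ q U) {Cq : ℝ} (hqb : ∀ U, q U ≤ Cq)
    (hq1 : ∀ U, ∫ v, q (update U (p.1, p.2.1.1) v)
      ∂(haarProbability (Matrix.specialUnitaryGroup (Fin 2) ℂ)) = 1)
    (hfac : ∀ U, coordAvg (haarProbability (Matrix.specialUnitaryGroup (Fin 2) ℂ)) s Q U =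
      q U * coordAvg (haarProbability (Matrix.specialUnitaryGroup (Fin 2) ℂ)) (insert (p.1, p.2.1.1) s) Q U)
    {y : Site d L} (hy : p.1 = y ∨ p.1.shift p.2.1.1 = y)
    (hqB : ∀ e : Edge d L, e.1 = y ∨ e.1.shift e.2 = y → e ≠ (p.1, p.2.1.1) →
      ∀ (U : GaugeConfig d L (Matrix.specialUnitaryGroup (Fin 2) ℂ))
        (v : Matrix.specialUnitaryGroup (Fin 2) ℂ), q (update U e v) = q U) :
    ∫ U, ∫ V, min
        (Real.exp (-β * wilsonAction (fundamentalRep (Fin 2)) U) /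
            (∫ W, Real.exp (-β * wilsonAction (fundamentalRep (Fin 2)) W)
              ∂Measure.pi (fun _ : Edge d L => haarProbability (Matrix.specialUnitaryGroup (Fin 2) ℂ))) *
          Q V)
        (Real.exp (-β * wilsonAction (fundamentalRep (Fin 2)) V) /
            (∫ W, Real.exp (-β * wilsonAction (fundamentalRep (Fin 2)) W)
              ∂Measure.pi (fun _ : Edge d L => haarProbability (Matrix.specialUnitaryGroup (Fin 2) ℂ))) *
          Q U)
        ∂Measure.pi (fun _ : Edge d L => haarProbability (Matrix.specialUnitaryGroup (Fin 2) ℂ))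
        ∂Measure.pi (fun _ : Edge d L => haarProbability (Matrix.specialUnitaryGroup (Fin 2) ℂ)) ≤
      1 - (1 / 4) * (1 - (9 + 2 * Real.log (((d : ℝ) - 1) * β)) / (((d : ℝ) - 1) * β)) := by
  haveI : SecondCountableTopology (Matrix (Fin 2) (Fin 2) ℂ) :=
    inferInstanceAs (SecondCountableTopology (Fin 2 → Fin 2 → ℂ))
  haveI : SecondCountableTopology (Matrix.specialUnitaryGroup (Fin 2) ℂ) :=
    Topology.IsEmbedding.subtypeVal.secondCountableTopology
  -- the central element `−1 ∈ SU(2)` acts by the scalar `−1 ≠ 1`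
  have hω : fundamentalRep (Fin 2)
      (Literature.Barriers.QuantumFields.scalarCenter 2 (-1) (by norm_num) (by norm_num)) =
      (-1 : ℂ) • (1 : Matrix (Fin 2) (Fin 2) ℂ) := rfl
  have hne : (-1 : ℂ) ≠ 1 := by norm_num
  -- the tree's explicit `SU(2)` plaquette floor at `p`
  have hw := wilsonExpectation_plaquette_ge_su2 (L := L) hd hK p.1 (ne_of_lt p.2.2)
  exact wilson_meanAccept_le_one_sub_quarter_floor (d := d) (L := L) (fundamentalRep (Fin 2)) (by norm_num)
    (continuous_fundamentalRep (Fin 2)) hL hω hne β p hs hQm hQ0 hQb hQ1 hqm hq0 hqb hq1 hfac hy hqB hw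

/-- **The same ceiling as `¾ + (9 + 2 log K)/(4K)`.** [ours] -/
theorem su2_meanAccept_le_three_quarters_add (hd : 2 ≤ d) (hL : 2 ≤ L) {β : ℝ}
    (hK : 2 ≤ ((d : ℝ) - 1) * β)
    (p : Plaquette d L) {s : Finset (Edge d L)}
    (hs : s ⊆ Finset.univ \
      {(p.1, p.2.1.1), (p.1.shift p.2.1.1, p.2.1.2), (p.1.shift p.2.1.2, p.2.1.1), (p.1, p.2.1.2)})
    {Q q : GaugeConfig d L (Matrix.specialUnitaryGroup (Fin 2) ℂ) → ℝ} (hQm : Measurable Q)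
    (hQ0 : ∀ U, 0 ≤ Q U) {CQ : ℝ} (hQb : ∀ U, Q U ≤ CQ)
    (hQ1 : ∫ U, Q U ∂Measure.pi (fun _ : Edge d L =>
      haarProbability (Matrix.specialUnitaryGroup (Fin 2) ℂ)) = 1)
    (hqm : Measurable q) (hq0 : ∀ U, 0 ≤ q U) {Cq : ℝ} (hqb : ∀ U, q U ≤ Cq)
    (hq1 : ∀ U, ∫ v, q (update U (p.1, p.2.1.1) v)
      ∂(haarProbability (Matrix.specialUnitaryGroup (Fin 2) ℂ)) = 1)
    (hfac : ∀ U, coordAvg (haarProbability (Matrix.specialUnitaryGroup (Fin 2) ℂ)) s Q U =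
      q U * coordAvg (haarProbability (Matrix.specialUnitaryGroup (Fin 2) ℂ)) (insert (p.1, p.2.1.1) s) Q U)
    {y : Site d L} (hy : p.1 = y ∨ p.1.shift p.2.1.1 = y)
    (hqB : ∀ e : Edge d L, e.1 = y ∨ e.1.shift e.2 = y → e ≠ (p.1, p.2.1.1) →
      ∀ (U : GaugeConfig d L (Matrix.specialUnitaryGroup (Fin 2) ℂ))
        (v : Matrix.specialUnitaryGroup (Fin 2) ℂ), q (update U e v) = q U) :
    ∫ U, ∫ V, min
        (Real.exp (-β * wilsonAction (fundamentalRep (Fin 2)) U) /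
            (∫ W, Real.exp (-β * wilsonAction (fundamentalRep (Fin 2)) W)
              ∂Measure.pi (fun _ : Edge d L => haarProbability (Matrix.specialUnitaryGroup (Fin 2) ℂ))) *
          Q V)
        (Real.exp (-β * wilsonAction (fundamentalRep (Fin 2)) V) /
            (∫ W, Real.exp (-β * wilsonAction (fundamentalRep (Fin 2)) W)
              ∂Measure.pi (fun _ : Edge d L => haarProbability (Matrix.specialUnitaryGroup (Fin 2) ℂ))) *
          Q U)
        ∂Measure.pi (fun _ : Edge d L => haarProbability (Matrix.specialUnitaryGroup (Fin 2) ℂ))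
        ∂Measure.pi (fun _ : Edge d L => haarProbability (Matrix.specialUnitaryGroup (Fin 2) ℂ)) ≤
      3 / 4 + (9 + 2 * Real.log (((d : ℝ) - 1) * β)) / (4 * (((d : ℝ) - 1) * β)) := by
  have h := su2_meanAccept_le_explicit (d := d) (L := L) hd hL hK p hs hQm hQ0 hQb hQ1 hqm hq0 hqb hq1
    hfac hy hqB
  have hKpos : 0 < ((d : ℝ) - 1) * β := by linarith
  have e : (1 : ℝ) - 1 / 4 * (1 - (9 + 2 * Real.log (((d : ℝ) - 1) * β)) / (((d : ℝ) - 1) * β)) =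
      3 / 4 + (9 + 2 * Real.log (((d : ℝ) - 1) * β)) / (4 * (((d : ℝ) - 1) * β)) := by
    field_simp
    ring
  exact h.trans (le_of_eq e)

/-- **`d = 4` reading** (`K = 3β`, `β ≥ 2/3`): `ā ≤ ¾ + (9 + 2 log(3β))/(12β)` at every volume `L ≥ 2`.
[ours] -/
theorem su2_meanAccept_le_explicit_dim_four {L : ℕ} [NeZero L] (hL : 2 ≤ L) {β : ℝ} (hβ : 2 / 3 ≤ β)
    (p : Plaquette 4 L) {s : Finset (Edge 4 L)}
    (hs : s ⊆ Finset.univ \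
      {(p.1, p.2.1.1), (p.1.shift p.2.1.1, p.2.1.2), (p.1.shift p.2.1.2, p.2.1.1), (p.1, p.2.1.2)})
    {Q q : GaugeConfig 4 L (Matrix.specialUnitaryGroup (Fin 2) ℂ) → ℝ} (hQm : Measurable Q)
    (hQ0 : ∀ U, 0 ≤ Q U) {CQ : ℝ} (hQb : ∀ U, Q U ≤ CQ)
    (hQ1 : ∫ U, Q U ∂Measure.pi (fun _ : Edge 4 L =>
      haarProbability (Matrix.specialUnitaryGroup (Fin 2) ℂ)) = 1)
    (hqm : Measurable q) (hq0 : ∀ U, 0 ≤ q U) {Cq : ℝ} (hqb : ∀ U, q U ≤ Cq)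
    (hq1 : ∀ U, ∫ v, q (update U (p.1, p.2.1.1) v)
      ∂(haarProbability (Matrix.specialUnitaryGroup (Fin 2) ℂ)) = 1)
    (hfac : ∀ U, coordAvg (haarProbability (Matrix.specialUnitaryGroup (Fin 2) ℂ)) s Q U =
      q U * coordAvg (haarProbability (Matrix.specialUnitaryGroup (Fin 2) ℂ)) (insert (p.1, p.2.1.1) s) Q U)
    {y : Site 4 L} (hy : p.1 = y ∨ p.1.shift p.2.1.1 = y)
    (hqB : ∀ e : Edge 4 L, e.1 = y ∨ e.1.shift e.2 = y → e ≠ (p.1, p.2.1.1) →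
      ∀ (U : GaugeConfig 4 L (Matrix.specialUnitaryGroup (Fin 2) ℂ))
        (v : Matrix.specialUnitaryGroup (Fin 2) ℂ), q (update U e v) = q U) :
    ∫ U, ∫ V, min
        (Real.exp (-β * wilsonAction (fundamentalRep (Fin 2)) U) /
            (∫ W, Real.exp (-β * wilsonAction (fundamentalRep (Fin 2)) W)
              ∂Measure.pi (fun _ : Edge 4 L => haarProbability (Matrix.specialUnitaryGroup (Fin 2) ℂ))) *
          Q V)
        (Real.exp (-β * wilsonAction (fundamentalRep (Fin 2)) V) /
            (∫ W, Real.exp (-β * wilsonAction (fundamentalRep (Fin 2)) W)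
              ∂Measure.pi (fun _ : Edge 4 L => haarProbability (Matrix.specialUnitaryGroup (Fin 2) ℂ))) *
          Q U)
        ∂Measure.pi (fun _ : Edge 4 L => haarProbability (Matrix.specialUnitaryGroup (Fin 2) ℂ))
        ∂Measure.pi (fun _ : Edge 4 L => haarProbability (Matrix.specialUnitaryGroup (Fin 2) ℂ)) ≤
      3 / 4 + (9 + 2 * Real.log (3 * β)) / (12 * β) := by
  have h3 : ((4 : ℕ) : ℝ) - 1 = 3 := by norm_num
  have h := su2_meanAccept_le_three_quarters_add (d := 4) (L := L) (by norm_num) hL (β := β)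
    (by rw [h3]; linarith) p hs hQm hQ0 hQb hQ1 hqm hq0 hqb hq1 hfac hy hqB
  rw [h3] at h
  have e : (4 : ℝ) * (3 * β) = 12 * β := by ring
  rw [e] at h
  exact h

end SU2

end Summit.Ventures.LatticeQCDFlow.Theory2.Autoregressive

end
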